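import Summits.CriticalPhenomena.PercolationContinuityZ3.Theorems.PercNearOneGluingNoHeavyConstsOneCopyBHK
import Summits.CriticalPhenomena.PercolationContinuityZ3.Theorems.PercNearOneGluingNoHeavyConstsHardCoreReductionPrelims
import HarnessLib

/-!
# One-copy repulsion, I: the cube inequality and reach-set locality (proof of `Consts.OneCopyRepelBHK`, part 1 of 2)

builds on p205010 (kernel theorem, internal audit signed; external expert review pending).  Support file (`--supports
stmt-CriticalPhenomena-4575`), lead seat `prim-nh-lead-4575` (gen 106); memo `run/shared/lean/prim/prim-nh-lead-4575/LEAD-GEN106.md` §5.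
Theorems only; no sorries; standard axioms.  Part 2 (`…ConstsOneCopyRepelProof.lean`) assembles `Consts.oneCopyRepelBHK_holds`.

`Consts.OneCopyRepelBHK` (typed in `…ConstsOneCopyBHK.lean`): for two copies `(a, a ∆ M)` of a folding fibre, a source set `S`, a
vertex set `T` and increasing cluster predicates `P, Q`, conditioning the FIRST copy to avoid `T` (second copy free),
`N(B∩U_P ; U_Q) + N(B∩U_Q ; U_P) ≤ N(B∩U_P∩U_Q ; ⊤) + N(B ; U_P∩U_Q)`.  PROOF (lead gen 106): slice the fibre by the reach set `W`
of `T` in the conditioned copy and the slice's fixed part `x`; on a slice `a = x ∪ y` with `y ⊆ F_W = M ∩ {pairs away from W}` free,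
the second copy is `(x ∆ M) \ y`, the first copy's cluster events are increasing in `y`, the second copy's decreasing, and
Kleitman's lemma four times on the cube `{y ⊆ F_W}` plus domination by the reflection `y ↦ F_W \ y` give the slice inequality.
This file: 
* `OneCopy.cube_four_kleitman` — the CUBE INEQUALITY: on `{y ⊆ F}`, for `p₀, q₀` increasing, `p₁, q₁` decreasing with
  `#p₀ ≤ #p₁`, `#q₀ ≤ #q₁`: `#{p₀∧q₁} + #{p₁∧q₀} ≤ #{p₀∧q₀} + #{p₁∧q₁}` (Kleitman ×4: the tree's
  `FoldingFibre.card_filter_mul_card_filter_le` / `card_filter_and_mul_card_le` on the fibre `fibre F ∅`, the down/down case by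
  reflection `FoldingFibre.card_filter_symmDiff_mem`; then `Z(N₀₁+N₁₀) ≤ A₀B₁+A₁B₀ ≤ A₀B₀+A₁B₁ ≤ Z(N₀₀+N₁₁)`);
* set algebra on a slice (`union_symmDiff_eq_sdiff`: `(x ∪ y) ∆ M = (x ∆ M) \ y`; `inter_eq_empty_of_sdiff_eq`);
* REACH-SET LOCALITY: the set `W` of vertices joined to `T` is unchanged by deleting or adding pairs with both endpoints outside `W`
  (`reachSet_sdiff_eq`, `reachSet_eq_of_sdiff`, via `reachable_mem_of_closed` — no open path leaves a set with closed boundary);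
* DOMINATION `cluster_subset_reflected`: on a slice, `C_S(x ∪ y) ⊆ C_S((x ∆ M) \ (F \ y))` — by the locality of `C_S` on
  `{S ↮ W}` (`Consts.HardCoreReduction.iUnion_openEdgeCluster_eq_sdiff_touch`) the first copy's cluster only uses pairs away from
  `W`, which are pairs of `x \ M` or of `y`, all open in the reflected second copy.
[cite: Kleitman1966, Lemma] [cite: Harris1960, Lemma 4.1] [cite: VandenbergHaggstromKahn2005, §1 p. 4 (identity (6): locality of `C_S` on `{S ↮ T}`)]
[cite: Linusson2011, Prop. 2.6]
-/

noncomputable section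

namespace Summit.CriticalPhenomena.PercolationContinuityZ3.Theorems

open Set Literature.Probability.Percolation Literature.Probability.Percolation.FoldingFibre
open scoped Classical symmDiff

namespace Consts

namespace OneCopy

/-! ## The cube inequality: Kleitman's lemma four times -/

section Cube

variable {α : Type*} [Fintype α]

omit [Fintype α] in
/-- On the cube `{y ⊆ F}` (= the folding fibre `fibre F ∅`), `y ∆ F = F \ y`. [folklore] -/
theorem symmDiff_eq_sdiff_of_subset {y F : Set α} (hy : y ⊆ F) : y ∆ F = F \ y := by
  ext e
  simp only [Set.mem_symmDiff, Set.mem_sdiff]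
  constructor
  · rintro (⟨he, hF⟩ | ⟨hF, he⟩)
    · exact absurd (hy he) hF
    · exact ⟨hF, he⟩
  · rintro ⟨hF, he⟩
    exact Or.inr ⟨hF, he⟩

/-- The folding fibre `fibre F ∅` is the cube `{y ⊆ F}`. [folklore] -/
theorem mem_fibre_empty_iff {y F : Set α} : y ∈ fibre F ∅ ↔ y ⊆ F := by
  rw [mem_fibre, Set.sdiff_eq_empty]

/-- **The cube inequality.**  On the cube `{y ⊆ F}` let `p₀, q₀` be increasing and `p₁, q₁` decreasing predicates with
`#{p₀} ≤ #{p₁}` and `#{q₀} ≤ #{q₁}`.  Then `#{p₀ ∧ q₁} + #{p₁ ∧ q₀} ≤ #{p₀ ∧ q₀} + #{p₁ ∧ q₁}`.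
Proof: Kleitman's lemma four times gives `Z·#{p₀∧q₁} ≤ #p₀·#q₁`, `Z·#{p₁∧q₀} ≤ #p₁·#q₀`, `#p₀·#q₀ ≤ Z·#{p₀∧q₀}`, `#p₁·#q₁ ≤ Z·#{p₁∧q₁}`
(`Z = 2^{|F|}`; the down/down case by reflecting `y ↦ F \ y`), and `#p₀#q₁ + #p₁#q₀ ≤ #p₀#q₀ + #p₁#q₁` is `(#p₁ − #p₀)(#q₁ − #q₀) ≥ 0`.
[cite: Kleitman1966, Lemma] -/
theorem cube_four_kleitman (F : Set α) (p₀ q₀ p₁ q₁ : Set α → Prop)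
    (hp₀ : ∀ y ⊆ F, ∀ y' ⊆ F, y ⊆ y' → p₀ y → p₀ y') (hq₀ : ∀ y ⊆ F, ∀ y' ⊆ F, y ⊆ y' → q₀ y → q₀ y')
    (hp₁ : ∀ y ⊆ F, ∀ y' ⊆ F, y ⊆ y' → p₁ y' → p₁ y) (hq₁ : ∀ y ⊆ F, ∀ y' ⊆ F, y ⊆ y' → q₁ y' → q₁ y)
    (hA : ((fibre F ∅).filter fun y => p₀ y).card ≤ ((fibre F ∅).filter fun y => p₁ y).card)
    (hB : ((fibre F ∅).filter fun y => q₀ y).card ≤ ((fibre F ∅).filter fun y => q₁ y).card) :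
    ((fibre F ∅).filter fun y => p₀ y ∧ q₁ y).card + ((fibre F ∅).filter fun y => p₁ y ∧ q₀ y).card ≤
      ((fibre F ∅).filter fun y => p₀ y ∧ q₀ y).card + ((fibre F ∅).filter fun y => p₁ y ∧ q₁ y).card := by
  -- monotonicity on the fibre `fibre F ∅ = {y ⊆ F}`
  have hP₀ : ∀ a ∈ fibre F ∅, ∀ b ∈ fibre F ∅, a ⊆ b → p₀ a → p₀ b :=
    fun a ha b hb hab => hp₀ a (mem_fibre_empty_iff.1 ha) b (mem_fibre_empty_iff.1 hb) hab
  have hQ₀ : ∀ a ∈ fibre F ∅, ∀ b ∈ fibre F ∅, a ⊆ b → q₀ a → q₀ b :=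
    fun a ha b hb hab => hq₀ a (mem_fibre_empty_iff.1 ha) b (mem_fibre_empty_iff.1 hb) hab
  have hP₁ : ∀ a ∈ fibre F ∅, ∀ b ∈ fibre F ∅, a ⊆ b → p₁ b → p₁ a :=
    fun a ha b hb hab => hp₁ a (mem_fibre_empty_iff.1 ha) b (mem_fibre_empty_iff.1 hb) hab
  have hQ₁ : ∀ a ∈ fibre F ∅, ∀ b ∈ fibre F ∅, a ⊆ b → q₁ b → q₁ a :=
    fun a ha b hb hab => hq₁ a (mem_fibre_empty_iff.1 ha) b (mem_fibre_empty_iff.1 hb) hab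
  -- up/up
  have h00 := card_filter_mul_card_filter_le F ∅ p₀ q₀ hP₀ hQ₀
  -- up/down twice
  have h01 := card_filter_and_mul_card_le F ∅ p₀ q₁ hP₀ hQ₁
  have h10' := card_filter_and_mul_card_le F ∅ q₀ p₁ hQ₀ hP₁
  have h10 : ((fibre F ∅).filter fun y => p₁ y ∧ q₀ y).card * (fibre F ∅).card ≤
      ((fibre F ∅).filter fun y => p₁ y).card * ((fibre F ∅).filter fun y => q₀ y).card := by
    have e : ((fibre F ∅).filter fun y => p₁ y ∧ q₀ y) = ((fibre F ∅).filter fun y => q₀ y ∧ p₁ y) :=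
      Finset.filter_congr fun y _ => and_comm
    rw [e, mul_comm (((fibre F ∅).filter fun y => p₁ y).card)]
    exact h10'
  -- down/down, by reflection `y ↦ y ∆ F = F \ y`
  have hrefl : ∀ (r : Set α → Prop), ((fibre F ∅).filter fun y => r (y ∆ F)).card = ((fibre F ∅).filter fun y => r y).card :=
    fun r => card_filter_symmDiff_mem F ∅ {y | r y}
  have hP₁' : ∀ a ∈ fibre F ∅, ∀ b ∈ fibre F ∅, a ⊆ b → p₁ (a ∆ F) → p₁ (b ∆ F) := by
    intro a ha b hb hab h
    have ha' := mem_fibre_empty_iff.1 ha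
    have hb' := mem_fibre_empty_iff.1 hb
    rw [symmDiff_eq_sdiff_of_subset ha'] at h
    rw [symmDiff_eq_sdiff_of_subset hb']
    exact hp₁ (F \ b) Set.sdiff_subset (F \ a) Set.sdiff_subset (Set.sdiff_subset_sdiff_right hab) h
  have hQ₁' : ∀ a ∈ fibre F ∅, ∀ b ∈ fibre F ∅, a ⊆ b → q₁ (a ∆ F) → q₁ (b ∆ F) := by
    intro a ha b hb hab h
    have ha' := mem_fibre_empty_iff.1 ha
    have hb' := mem_fibre_empty_iff.1 hb
    rw [symmDiff_eq_sdiff_of_subset ha'] at h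
    rw [symmDiff_eq_sdiff_of_subset hb']
    exact hq₁ (F \ b) Set.sdiff_subset (F \ a) Set.sdiff_subset (Set.sdiff_subset_sdiff_right hab) h
  have h11' := card_filter_mul_card_filter_le F ∅ (fun y => p₁ (y ∆ F)) (fun y => q₁ (y ∆ F)) hP₁' hQ₁'
  have h11 : ((fibre F ∅).filter fun y => p₁ y).card * ((fibre F ∅).filter fun y => q₁ y).card ≤
      (fibre F ∅).card * ((fibre F ∅).filter fun y => p₁ y ∧ q₁ y).card := by
    have e1 := hrefl p₁
    have e2 := hrefl q₁
    have e3 := hrefl (fun y => p₁ y ∧ q₁ y)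
    have e3' : ((fibre F ∅).filter fun a => p₁ (a ∆ F) ∧ q₁ (a ∆ F)).card =
        ((fibre F ∅).filter fun y => p₁ y ∧ q₁ y).card := by
      convert e3 using 3
    rw [e1, e2, e3'] at h11'
    exact h11'
  -- arithmetic: Z·(N₀₁ + N₁₀) ≤ A₀B₁ + A₁B₀ ≤ A₀B₀ + A₁B₁ ≤ Z·(N₀₀ + N₁₁), then cancel Z > 0
  set Z := (fibre F ∅).card with hZ
  set A₀ := ((fibre F ∅).filter fun y => p₀ y).card
  set A₁ := ((fibre F ∅).filter fun y => p₁ y).card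
  set B₀ := ((fibre F ∅).filter fun y => q₀ y).card
  set B₁ := ((fibre F ∅).filter fun y => q₁ y).card
  set N₀₀ := ((fibre F ∅).filter fun y => p₀ y ∧ q₀ y).card
  set N₁₁ := ((fibre F ∅).filter fun y => p₁ y ∧ q₁ y).card
  set N₀₁ := ((fibre F ∅).filter fun y => p₀ y ∧ q₁ y).card
  set N₁₀ := ((fibre F ∅).filter fun y => p₁ y ∧ q₀ y).card
  have hZpos : 0 < Z := by
    rw [hZ, Finset.card_pos]
    exact ⟨∅, mem_fibre_empty_iff.2 (Set.empty_subset F)⟩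
  have hmid : A₀ * B₁ + A₁ * B₀ ≤ A₀ * B₀ + A₁ * B₁ := by nlinarith [hA, hB]
  have hchain : Z * (N₀₁ + N₁₀) ≤ Z * (N₀₀ + N₁₁) := by nlinarith [h00, h01, h10, h11, hmid]
  exact Nat.le_of_mul_le_mul_left hchain hZpos

end Cube

/-! ## Set algebra on a slice -/

section SetAlgebra

variable {α : Type*}

/-- On a slice: `x ∩ F = ∅`, `y ⊆ F ⊆ M` ⇒ the second copy of `x ∪ y` is `(x ∆ M) \ y`. [folklore] -/
theorem union_symmDiff_eq_sdiff {x y F M : Set α} (hxF : x ∩ F = ∅) (hyF : y ⊆ F) (hFM : F ⊆ M) :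
    (x ∪ y) ∆ M = (x ∆ M) \ y := by
  ext e
  simp only [Set.mem_symmDiff, Set.mem_union, Set.mem_sdiff]
  have hx : e ∈ y → e ∉ x := fun hy hx => by
    have : e ∈ x ∩ F := ⟨hx, hyF hy⟩
    rw [hxF] at this; exact this
  have hm : e ∈ y → e ∈ M := fun hy => hFM (hyF hy)
  tauto

/-- On a slice: the block value of `x \ (M \ F) = u` with `u ∩ F = ∅` is empty, `x ∩ F = ∅`. [folklore] -/
theorem inter_eq_empty_of_sdiff_eq {x u F M : Set α} (hx : x \ (M \ F) = u) (huF : Disjoint u F) :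
    x ∩ F = ∅ := by
  ext e
  simp only [Set.mem_inter_iff, Set.mem_empty_iff_false, iff_false, not_and]
  intro hex heF
  have : e ∈ x \ (M \ F) := ⟨hex, fun h => h.2 heF⟩
  rw [hx] at this
  exact Set.disjoint_left.1 huF this heF

end SetAlgebra

/-! ## Reach sets: locality away from the cluster of `T` -/

section Reach

variable {V : Type*}

/-- **No escape through a closed boundary.**  If every open pair with an endpoint in `W` has both endpoints in `W`, then open
paths from inside `W` stay inside `W`. [folklore] -/
theorem reachable_mem_of_closed {ω : BondConfig V} {W : Set V}
    (hW : ∀ e ∈ ω, ∀ x ∈ e, x ∈ W → ∀ z ∈ e, z ∈ W) {t v : V} (ht : t ∈ W)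
    (h : (openGraph ω).Reachable t v) : v ∈ W := by
  rw [SimpleGraph.reachable_iff_reflTransGen] at h
  induction h with
  | refl => exact ht
  | @tail b c _ hbc ih =>
    obtain ⟨hω, _⟩ := (openGraph_adj ω b c).1 hbc
    exact hW _ hω b (Sym2.mem_mk_left b c) ih c (Sym2.mem_mk_right b c)

/-- **Deleting pairs away from the reach set of `T` does not change it** (direction ⊆): if `W` is the set of vertices joined to
`T` in `ω` and every pair of `F` has all its endpoints outside `W`, then every vertex joined to `T` in `ω` is joined to `T` in
`ω \ F` (an open path from `T` never uses a pair of `F`). [folklore] -/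
theorem reachable_sdiff_of_reachSet {ω F : BondConfig V} {T : Set V} {W : Set V}
    (hW : {v | ∃ t ∈ T, (openGraph ω).Reachable t v} = W) (hF : ∀ e ∈ F, ∀ x ∈ e, x ∉ W)
    {t v : V} (ht : t ∈ T) (h : (openGraph ω).Reachable t v) : (openGraph (ω \ F)).Reachable t v := by
  rw [SimpleGraph.reachable_iff_reflTransGen] at h
  induction h with
  | refl => exact SimpleGraph.Reachable.refl t
  | @tail b c hsb hbc ih =>
    have hb : (openGraph ω).Reachable t b := (SimpleGraph.reachable_iff_reflTransGen t b).2 hsb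
    have hbW : b ∈ W := by rw [← hW]; exact ⟨t, ht, hb⟩
    obtain ⟨hω, hne⟩ := (openGraph_adj ω b c).1 hbc
    have hnot : s(b, c) ∉ F := fun hF' => hF _ hF' b (Sym2.mem_mk_left b c) hbW
    exact ih.trans (SimpleGraph.Adj.reachable ((openGraph_adj _ b c).2 ⟨⟨hω, hnot⟩, hne⟩))

/-- **Reach set unchanged by deleting pairs away from it.** [folklore] -/
theorem reachSet_sdiff_eq {ω F : BondConfig V} {T : Set V} {W : Set V}
    (hW : {v | ∃ t ∈ T, (openGraph ω).Reachable t v} = W) (hF : ∀ e ∈ F, ∀ x ∈ e, x ∉ W) :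
    {v | ∃ t ∈ T, (openGraph (ω \ F)).Reachable t v} = W := by
  ext v
  constructor
  · rintro ⟨t, ht, h⟩
    rw [← hW]
    exact ⟨t, ht, h.mono (openGraph_mono Set.sdiff_subset)⟩
  · intro hv
    have hv' : v ∈ {v | ∃ t ∈ T, (openGraph ω).Reachable t v} := by rw [hW]; exact hv
    obtain ⟨t, ht, h⟩ := hv'
    exact ⟨t, ht, reachable_sdiff_of_reachSet hW hF ht h⟩

/-- **Reach set unchanged by ADDING pairs away from it**: if the reach set of `T` in `ω \ F` is `W` and every pair of `F` has its
endpoints outside `W`, then the reach set of `T` in `ω` is `W` too (no open pair of `ω` leaves `W`). [folklore] -/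
theorem reachSet_eq_of_sdiff {ω F : BondConfig V} {T : Set V} {W : Set V}
    (hW : {v | ∃ t ∈ T, (openGraph (ω \ F)).Reachable t v} = W) (hF : ∀ e ∈ F, ∀ x ∈ e, x ∉ W) :
    {v | ∃ t ∈ T, (openGraph ω).Reachable t v} = W := by
  -- closure of `W` under the pairs of `ω`
  have hcl : ∀ e ∈ ω, ∀ x ∈ e, x ∈ W → ∀ z ∈ e, z ∈ W := by
    intro e he x hx hxW z hz
    by_cases heF : e ∈ F
    · exact absurd hxW (hF e heF x hx)
    · -- `e` is open in `ω \ F`, `x ∈ W` is reached there, hence so is `z`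
      have hxW' : x ∈ {v | ∃ t ∈ T, (openGraph (ω \ F)).Reachable t v} := by rw [hW]; exact hxW
      obtain ⟨t, ht, htx⟩ := hxW'
      rw [← hW]
      refine ⟨t, ht, ?_⟩
      by_cases hxz : x = z
      · subst hxz; exact htx
      · have he' : s(x, z) = e := ((Sym2.mem_and_mem_iff hxz).1 ⟨hx, hz⟩).symm
        have hadj : (openGraph (ω \ F)).Adj x z :=
          (openGraph_adj _ x z).2 ⟨by rw [he']; exact ⟨he, heF⟩, hxz⟩
        exact htx.trans hadj.reachable
  ext v
  constructor
  · rintro ⟨t, ht, h⟩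
    have htW : t ∈ W := by rw [← hW]; exact ⟨t, ht, SimpleGraph.Reachable.refl t⟩
    exact reachable_mem_of_closed hcl htW h
  · intro hv
    have hv' : v ∈ {v | ∃ t ∈ T, (openGraph (ω \ F)).Reachable t v} := by rw [hW]; exact hv
    obtain ⟨t, ht, h⟩ := hv'
    exact ⟨t, ht, h.mono (openGraph_mono Set.sdiff_subset)⟩

/-- On `{S ↮ T}`: no source is joined to any vertex of the reach set of `T`. [folklore] -/
theorem not_reachable_of_reachSet {ω : BondConfig V} {S T : Set V} {W : Set V}
    (hW : {v | ∃ t ∈ T, (openGraph ω).Reachable t v} = W) (hS : ∀ s ∈ S, s ∉ W) :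
    ∀ s ∈ S, ∀ w ∈ W, ¬ (openGraph ω).Reachable s w := by
  intro s hs w hw hsw
  have hw' : w ∈ {v | ∃ t ∈ T, (openGraph ω).Reachable t v} := by rw [hW]; exact hw
  obtain ⟨t, ht, htw⟩ := hw'
  exact hS s hs (by rw [← hW]; exact ⟨t, ht, htw.trans hsw.symm⟩)

/-- **Domination on a slice.**  Let `W` be the reach set of `T` in `x`, `S ∩ W = ∅`, `F` the reflected pairs away from `W`
(`F ⊆ M`, every pair of `F` has its endpoints outside `W`, and every pair of `M` away from `W` lies in `F`), `x ∩ F = ∅`, `y ⊆ F`.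
Then the union cluster of `S` in the first copy `x ∪ y` is contained in the union cluster of `S` in the reflected second copy
`(x ∆ M) \ (F \ y)`: the first copy's cluster only uses pairs away from `W` (locality on `{S ↮ W}`), i.e. pairs of `x \ M` or of `y`,
and those are open in `(x ∆ M) \ (F \ y)`. [cite: VandenbergHaggstromKahn2005, §1 p. 4 (identity (6))] -/
theorem cluster_subset_reflected {x y F M : BondConfig V} {S T : Set V} {W : Set V}
    (hW : {v | ∃ t ∈ T, (openGraph x).Reachable t v} = W) (hS : ∀ s ∈ S, s ∉ W)
    (hF : ∀ e ∈ F, ∀ z ∈ e, z ∉ W) (hMF : ∀ e ∈ M, (∀ z ∈ e, z ∉ W) → e ∈ F) (hFM : F ⊆ M) (hxF : x ∩ F = ∅)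
    (hyF : y ⊆ F) :
    (⋃ s ∈ S, openEdgeCluster (x ∪ y) s) ⊆ ⋃ s ∈ S, openEdgeCluster ((x ∆ M) \ (F \ y)) s := by
  -- the reach set of `T` in `x ∪ y` is still `W`
  have hxyF : (x ∪ y) \ y = x := by
    ext e
    simp only [Set.mem_sdiff, Set.mem_union]
    constructor
    · rintro ⟨hex | hey, hny⟩
      · exact hex
      · exact absurd hey hny
    · intro hex
      refine ⟨Or.inl hex, fun hey => ?_⟩
      have : e ∈ x ∩ F := ⟨hex, hyF hey⟩
      rw [hxF] at this; exact this
  have hyW : ∀ e ∈ y, ∀ z ∈ e, z ∉ W := fun e he => hF e (hyF he)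
  have hW' : {v | ∃ t ∈ T, (openGraph (x ∪ y)).Reachable t v} = W := by
    apply reachSet_eq_of_sdiff (F := y) _ hyW
    rw [hxyF]; exact hW
  -- locality: `C_S(x ∪ y) = C_S((x ∪ y) \ touch W)`
  have hloc := HardCoreReduction.iUnion_openEdgeCluster_eq_sdiff_touch (not_reachable_of_reachSet hW' hS)
  rw [hloc]
  refine Set.iUnion₂_mono fun s _ => BHK2006.openEdgeCluster_mono ?_ s
  -- `(x ∪ y) \ touch W ⊆ (x ∆ M) \ (F \ y)`
  intro e he
  obtain ⟨hexy, hnt⟩ := he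
  have hout : ∀ z ∈ e, z ∉ W := fun z hz hzW => hnt ⟨z, hzW, hz⟩
  rw [Set.mem_sdiff, Set.mem_symmDiff, Set.mem_sdiff]
  rcases hexy with hex | hey
  · have heF : e ∉ F := fun heF => by
      have : e ∈ x ∩ F := ⟨hex, heF⟩
      rw [hxF] at this; exact this
    have heM : e ∉ M := fun heM => heF (hMF e heM hout)
    exact ⟨Or.inl ⟨hex, heM⟩, fun h => heF h.1⟩
  · have heF : e ∈ F := hyF hey
    have hex : e ∉ x := fun hex => by
      have : e ∈ x ∩ F := ⟨hex, heF⟩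
      rw [hxF] at this; exact this
    exact ⟨Or.inr ⟨hFM heF, hex⟩, fun h => h.2 hey⟩

end Reach


end OneCopy

end Consts

end Summit.CriticalPhenomena.PercolationContinuityZ3.Theorems
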